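import Summits.QuantumAdvantage.QuantumAdvantage.Theorems.CharDialFormJunta
import Summits.QuantumAdvantage.QuantumAdvantage.Theorems.CharDialJLinPeel
import Summits.QuantumAdvantage.AdviceFreeQNC0.WalkHardFJuntaCuts
import HarnessLib

/-!
# Well-spread rank-`r` junta ⊕ linear-form strategies lose (SliceDial rev 8: the first piece of the residual R2′)

decomp-qadv lens-6 («barrier-complement carving») g11, tree part 18 (rev 8; extended revs 9, 10, 12).  Prop-free, sorry-free.  IMPORTS part 16
`CharDialFormJunta.lean` of the same LAND package (`WindowCounter.formJunta_small`, `formSum`, `linF`, the character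
lemmas) and the landed `Theorems.CharDialJLinPeel` (`JLinData`, `winCount`), `AdviceFreeQNC0.WalkHardFJuntaCuts` (the
junta rung) — so it lands AFTER part 16 (independently of parts 12 / 17).

CONTENT.  §J (namespace `…AdviceFreeQNC0.WindowCounter`): the `r`-FORM DIAL `formStratR A Y : u ↦ Y_{(⟨A_j,u⟩)_j}(·,u)`
and its Fourier reduction over `(ℤ/p)^r` — `ite_eq_sum_charR` (orthogonality), `linF_comb` (`⟨Σ_j t_j A_j, u⟩ =
Σ_j t_j ⟨A_j,u⟩`), `class_count_le_formR` (`p^r·#{vec u = s ∧ WIN_y} ≤ #WIN_y + Σ_{t ≠ 0} ‖A₁^{Σ_j t_j A_j}(y)‖`),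
`form_reductionR` (main term = the class strategies' average, `p^r − 1` error terms each a form-twisted win sum in a
COMBINED direction; rate `(1+θ₀)/2` for any fixed `r`), `formJuntaR_hard` (fed with `formJunta_small`).  §K (namespace
`…AdviceFreeQNC0.JLinPeel`): `strat_eq_formStratR` (re-presenting a rank-`r` pencil through the tables) and
**`spreadRank_hard`**: for every prime `p ≥ 5` and every `r` there are `θ < 1`, `n₀` such that every `D : JLinData p n`
(`n ≥ n₀`) with `log₂ n`-juntas whose NON-BLIND cuts' forms lie in the span of `r` directions `A₀,…,A_{r-1}` ALL of whose
nonzero combinations are dense (`2·#supp(Σ_j t_j A_j) ≥ n`, `t ≠ 0`: a WELL-SPREAD pencil) wins α's u-walk game on at most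
`θ·2ⁿ` inputs.  `r = 1` with `A₀` dense is the dense half of the rank-one aside 27049 (part 17); `r ≥ 2` is NEW territory
inside SliceDial's residual R2′ (strategies of semantic rank ≥ 2), decided by the same class-conditioned block product.
(rev 9) §J′/§K′ polylog juntas `spreadRank_hard_pow`; (rev 10) §L/§K″ ONE SPARSE LINE `lineSpread_hard` — one arbitrary
direction `A₀` plus `r` directions spread off its line; (rev 12) §M the generic `W`-DETERMINED DIAL slicing lemma
`dial_sparse_junta_hard` (selector depending on `≤ n/2` bits, junta tables ⇒ loses; no primality) and §K‴
`twoSparse_smallUnion_hard` — two sparse forms whose supports together touch `≤ n/2` coordinates lose, so the node's exact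
residual of rank two is «two sparse forms COVERING more than half of the coordinates» (`TwoSparseCoverHard`).
-/

noncomputable section
open Finset

namespace Summit.QuantumAdvantage.AdviceFreeQNC0.WindowCounter

open Summit.QuantumAdvantage.AdviceFreeQNC0

/-! ## §J WELL-SPREAD PENCILS OF ANY FIXED RANK: the `r`-form dial and its Fourier reduction over `(ℤ/p)^r`

A strategy whose cuts' forms all lie in the span of `r` directions `A₀,…,A_{r-1}` is the `r`-FORM DIAL
`u ↦ Y_{(⟨A_j,u⟩)_j}(·,u)` of its class strategies `Y_s`, `s ∈ (ℤ/p)^r`.  Expanding the class indicator over the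
characters of `(ℤ/p)^r` (`ite_eq_sum_charR`) writes `p^r` times the win count as the sum of the class strategies' win
counts plus `p^r − 1` error terms per class, each a form-twisted win sum `A₁^{b}(Y_s)` in the COMBINED direction
`b = Σ_j t_j A_j` (`linF_comb`, `class_count_le_formR`).  So if EVERY nonzero combination is dense, `formJunta_small`
bounds every error term and the junta rung bounds the main term: `form_reductionR` (rate `(1+θ₀)/2`, any fixed `r`),
`formJuntaR_hard`.  `r = 1` is `form_reduction`; the rank-one aside used only that case. -/

section SpreadForm

variable (p : ℕ) [Fact p.Prime] {n : ℕ}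

/-- the combined direction `Σ_j t_j A_j`. -/
def comb {r : ℕ} (t : Fin r → ZMod p) (A : Fin r → Fin n → ZMod p) : Fin n → ZMod p := fun i => ∑ j, t j * A j i

/-- CharDialSpreadRankA helper `linF_comb` (decomp-qadv land package; see the module docstring). -/
theorem linF_comb {r : ℕ} (t : Fin r → ZMod p) (A : Fin r → Fin n → ZMod p) (u : Fin n → Bool) :
    linF p (comb p t A) u = ∑ j, t j * linF p (A j) u := by
  unfold linF comb
  simp_rw [mul_sum]
  rw [sum_comm]
  refine sum_congr rfl fun i _ => ?_
  by_cases h : u i <;> simp [h]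

/-- orthogonality over `(ℤ/p)^r`: `[x = 0]·p^r = Σ_t ψ(Σ_j t_j x_j)`. -/
theorem ite_eq_sum_charR {r : ℕ} (x : Fin r → ZMod p) :
    (if x = 0 then ((p : ℂ) ^ r) else 0) = ∑ t : Fin r → ZMod p, (ZMod.stdAddChar (∑ j, t j * x j) : ℂ) := by
  have h1 : (if x = 0 then ((p : ℂ) ^ r) else 0) = ∏ j : Fin r, (if x j = 0 then (p : ℂ) else 0) := by
    split_ifs with hx
    · simp [hx]
    · obtain ⟨j, hj⟩ : ∃ j, x j ≠ 0 := by
        by_contra hc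
        push Not at hc
        exact hx (funext hc)
      exact (prod_eq_zero (mem_univ j) (if_neg hj)).symm
  rw [h1, prod_congr rfl fun j _ => ite_eq_sum_char p (x j),
    Finset.prod_univ_sum (fun _ => (univ : Finset (ZMod p))) (fun j t₀ => (ZMod.stdAddChar (t₀ * x j) : ℂ)),
    Fintype.piFinset_univ]
  refine sum_congr rfl fun t _ => ?_
  rw [char_sum]

/-- the class vector `(⟨A_j,u⟩)_j`. -/
def vecF {r : ℕ} (A : Fin r → Fin n → ZMod p) (u : Fin n → Bool) : Fin r → ZMod p := fun j => linF p (A j) u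

/-- the `r`-form dial: consult the class vector, then play the class strategy. -/
def formStratR {r : ℕ} (A : Fin r → Fin n → ZMod p) (Y : (Fin r → ZMod p) → Fin (n + 1) → (Fin n → Bool) → Bool) :
    Fin (n + 1) → (Fin n → Bool) → Bool := fun g u => Y (vecF p A u) g u

/-- CharDialSpreadRankA helper `card_win_formR_eq_sum` (decomp-qadv land package; see the module docstring). -/
theorem card_win_formR_eq_sum (c : ℕ) {r : ℕ} (A : Fin r → Fin n → ZMod p)
    (Y : (Fin r → ZMod p) → Fin (n + 1) → (Fin n → Bool) → Bool) :
    #{u : Fin n → Bool | ringWinU c (formStratR p A Y) u = true} =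
      ∑ s : Fin r → ZMod p, #{u : Fin n → Bool | ringWinU c (Y s) u = true ∧ vecF p A u = s} := by
  rw [card_eq_sum_card_fiberwise (f := fun u : Fin n → Bool => vecF p A u) (t := univ) fun u _ => mem_univ _]
  refine sum_congr rfl fun s _ => ?_
  rw [filter_filter]
  congr 1
  refine filter_congr fun u _ => ?_
  refine ⟨fun h => ⟨?_, h.2⟩, fun h => ⟨?_, h.2⟩⟩
  · rw [← h.1]; symm
    exact UnreadTwist.ringWinU_congr fun g => by simp only [formStratR, h.2]
  · rw [← h.1]
    exact UnreadTwist.ringWinU_congr fun g => by simp only [formStratR, h.2]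

/-- the class bound over `(ℤ/p)^r`: `p^r · #{vec u = s, WIN_y} ≤ #WIN_y + Σ_{t ≠ 0} ‖A₁^{Σ t_j A_j}(y)‖`. -/
theorem class_count_le_formR (c : ℕ) {r : ℕ} (A : Fin r → Fin n → ZMod p) (y : Fin (n + 1) → (Fin n → Bool) → Bool)
    (s : Fin r → ZMod p) :
    (p : ℝ) ^ r * #{u : Fin n → Bool | ringWinU c y u = true ∧ vecF p A u = s} ≤
      #{u : Fin n → Bool | ringWinU c y u = true} +
        ∑ t ∈ univ.erase (0 : Fin r → ZMod p), ‖formSum p (comb p t A) c y 1‖ := by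
  have hid : ((p : ℂ) ^ r) * ((#{u : Fin n → Bool | ringWinU c y u = true ∧ vecF p A u = s} : ℕ) : ℂ) =
      ∑ t : Fin r → ZMod p, ZMod.stdAddChar (-(∑ j, t j * s j)) * formSum p (comb p t A) c y 1 := by
    have e1 : ((#{u : Fin n → Bool | ringWinU c y u = true ∧ vecF p A u = s} : ℕ) : ℂ) =
        ∑ u : Fin n → Bool, (if ringWinU c y u = true then (1 : ℂ) else 0) *
          (if vecF p A u - s = 0 then (1 : ℂ) else 0) := by
      rw [← sum_boole]
      refine sum_congr rfl fun u _ => ?_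
      by_cases h1 : vecF p A u = s <;> by_cases h2 : ringWinU c y u = true <;> simp [h1, h2, sub_eq_zero]
    rw [e1, mul_sum]
    have e2 : ∀ u : Fin n → Bool, ((p : ℂ) ^ r) * ((if ringWinU c y u = true then (1 : ℂ) else 0) *
        (if vecF p A u - s = 0 then (1 : ℂ) else 0)) =
        ∑ t : Fin r → ZMod p, ZMod.stdAddChar (-(∑ j, t j * s j)) *
          ((if ringWinU c y u = true then (1 : ℂ) else 0) * (ZMod.stdAddChar (1 * linF p (comb p t A) u) : ℂ)) := by
      intro u
      have h := ite_eq_sum_charR p (vecF p A u - s)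
      rw [show (if vecF p A u - s = 0 then ((p : ℂ) ^ r) else 0) =
          ((p : ℂ) ^ r) * (if vecF p A u - s = 0 then 1 else 0) by rw [mul_ite, mul_one, mul_zero]] at h
      rw [mul_left_comm, h, mul_sum]
      refine sum_congr rfl fun t _ => ?_
      have e3 : ∑ j, t j * (vecF p A u - s) j = 1 * linF p (comb p t A) u + -(∑ j, t j * s j) := by
        rw [one_mul, linF_comb, ← sub_eq_add_neg, ← sum_sub_distrib]
        refine sum_congr rfl fun j _ => ?_
        rw [Pi.sub_apply, mul_sub]; rfl
      rw [e3, AddChar.map_add_eq_mul]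
      ring
    simp only [e2]
    rw [sum_comm]
    refine sum_congr rfl fun t _ => ?_
    rw [formSum, mul_sum]
  have hA0 : formSum p (comb p 0 A) c y 1 = (#{u : Fin n → Bool | ringWinU c y u = true} : ℂ) := by
    rw [formSum]
    have : ∀ u : Fin n → Bool, linF p (comb p 0 A) u = 0 := fun u => by simp [linF, comb]
    simp only [this, mul_zero, AddChar.map_zero_eq_one, mul_one]
    rw [sum_boole]
  have hnorm : (p : ℝ) ^ r * #{u : Fin n → Bool | ringWinU c y u = true ∧ vecF p A u = s} ≤
      ∑ t : Fin r → ZMod p, ‖formSum p (comb p t A) c y 1‖ := by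
    have : (p : ℝ) ^ r * #{u : Fin n → Bool | ringWinU c y u = true ∧ vecF p A u = s} =
        ‖((p : ℂ) ^ r) * ((#{u : Fin n → Bool | ringWinU c y u = true ∧ vecF p A u = s} : ℕ) : ℂ)‖ := by
      rw [norm_mul, norm_pow, Complex.norm_natCast, Complex.norm_natCast]
    rw [this, hid]
    refine le_trans (norm_sum_le _ _) (sum_le_sum fun t _ => ?_)
    rw [norm_mul, norm_char, one_mul]
  rw [← add_sum_erase univ (fun t => ‖formSum p (comb p t A) c y 1‖) (mem_univ (0 : Fin r → ZMod p)), hA0] at hnorm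
  simpa only [Complex.norm_natCast] using hnorm

/-- **`r`-FORM-DIAL FOURIER REDUCTION on well-spread pencils** (every nonzero combination dense; explicit rate
`(1+θ₀)/2`, any fixed `r`). -/
theorem form_reductionR (good : ∀ {n : ℕ}, ℕ → (Fin (n + 1) → (Fin n → Bool) → Bool) → Prop) {θ₀ : ℝ}
    (h1 : ∃ n₀ : ℕ, ∀ n ≥ n₀, ∀ (c : ℕ) (y : Fin (n + 1) → (Fin n → Bool) → Bool),
      good c y → (#{u : Fin n → Bool | ringWinU c y u = true} : ℝ) ≤ θ₀ * 2 ^ n)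
    (h2 : ∀ ε : ℝ, 0 < ε → ∃ n₁ : ℕ, ∀ n ≥ n₁, ∀ (c : ℕ) (a : Fin n → ZMod p)
      (y : Fin (n + 1) → (Fin n → Bool) → Bool), good c y → n ≤ 2 * (univ.filter fun i : Fin n => a i ≠ 0).card →
        ∀ t : ZMod p, t ≠ 0 → ‖formSum p a c y t‖ ≤ ε * 2 ^ n) (hθ₀ : θ₀ < 1) (r : ℕ) :
    ∃ n₂ : ℕ, ∀ n ≥ n₂, ∀ (c : ℕ) (A : Fin r → Fin n → ZMod p)
      (Y : (Fin r → ZMod p) → Fin (n + 1) → (Fin n → Bool) → Bool),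
      (∀ t : Fin r → ZMod p, t ≠ 0 → n ≤ 2 * (univ.filter fun i : Fin n => comb p t A i ≠ 0).card) →
        (∀ s, good c (Y s)) →
        (#{u : Fin n → Bool | ringWinU c (formStratR p A Y) u = true} : ℝ) ≤ (θ₀ + (1 - θ₀) / 2) * 2 ^ n := by
  obtain ⟨n₀, hn₀⟩ := h1
  have hp0 : (0 : ℝ) < p := by exact_mod_cast (Fact.out : p.Prime).pos
  have hpr : (0 : ℝ) < (p : ℝ) ^ r := by positivity
  set ε : ℝ := (1 - θ₀) / 2 with hε
  have hε0 : 0 < ε := by rw [hε]; linarith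
  obtain ⟨n₁, hn₁⟩ := h2 (ε / p ^ r) (by positivity)
  refine ⟨max n₀ n₁, fun n hn c A Y hdense hY => ?_⟩
  have hA : n₀ ≤ n := le_trans (le_max_left _ _) hn
  have hB : n₁ ≤ n := le_trans (le_max_right _ _) hn
  have hcardT : ((univ.erase (0 : Fin r → ZMod p)).card : ℝ) ≤ (p : ℝ) ^ r := by
    have : (univ.erase (0 : Fin r → ZMod p)).card ≤ p ^ r :=
      le_trans (card_erase_le) (by rw [card_univ, Fintype.card_fun, ZMod.card, Fintype.card_fin])
    exact_mod_cast this
  have hcls : ∀ s : Fin r → ZMod p,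
      (p : ℝ) ^ r * #{u : Fin n → Bool | ringWinU c (Y s) u = true ∧ vecF p A u = s} ≤ θ₀ * 2 ^ n + ε * 2 ^ n := by
    intro s
    refine le_trans (class_count_le_formR p c A (Y s) s) (add_le_add (hn₀ n hA c _ (hY s)) ?_)
    calc ∑ t ∈ univ.erase (0 : Fin r → ZMod p), ‖formSum p (comb p t A) c (Y s) 1‖
        ≤ ∑ t ∈ univ.erase (0 : Fin r → ZMod p), ε / p ^ r * 2 ^ n :=
          sum_le_sum fun t ht => hn₁ n hB c (comb p t A) _ (hY s) (hdense t (ne_of_mem_erase ht)) 1 one_ne_zero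
      _ ≤ (p : ℝ) ^ r * (ε / p ^ r * 2 ^ n) := by
          rw [sum_const, nsmul_eq_mul]
          exact mul_le_mul_of_nonneg_right hcardT (by positivity)
      _ = ε * 2 ^ n := by field_simp
  have hsum : (p : ℝ) ^ r * #{u : Fin n → Bool | ringWinU c (formStratR p A Y) u = true} ≤
      (p : ℝ) ^ r * (θ₀ * 2 ^ n + ε * 2 ^ n) := by
    rw [card_win_formR_eq_sum p c A Y]
    push_cast
    rw [mul_sum]
    calc _ ≤ ∑ s : Fin r → ZMod p, (θ₀ * 2 ^ n + ε * 2 ^ n) := sum_le_sum fun s _ => hcls s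
      _ = (p : ℝ) ^ r * (θ₀ * 2 ^ n + ε * 2 ^ n) := by
          rw [sum_const, card_univ, Fintype.card_fun, ZMod.card, Fintype.card_fin, nsmul_eq_mul]; push_cast; ring
  have := le_of_mul_le_mul_left hsum hpr
  linarith

/-- **well-spread `log₂ n`-junta ⊕ `r`-form strategies lose** (rate `(1+θ₀)/2` from the junta rung `θ₀`; any fixed `r`):
the `r`-form dial of `log₂ n`-junta class strategies over directions `A` all of whose nonzero combinations are dense. -/
theorem formJuntaR_hard (hp : 5 ≤ p) {θ₀ : ℝ} (hθ₀ : θ₀ < 1)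
    (h1 : ∃ n₀ : ℕ, ∀ n ≥ n₀, ∀ (c : ℕ) (y : Fin (n + 1) → (Fin n → Bool) → Bool),
      (∀ g, ∃ J : Finset (Fin n), J.card ≤ Nat.log 2 n ∧ ∀ u v : Fin n → Bool, (∀ i ∈ J, u i = v i) → y g u = y g v) →
        (#{u : Fin n → Bool | ringWinU c y u = true} : ℝ) ≤ θ₀ * 2 ^ n) (r : ℕ) :
    ∃ n₂ : ℕ, ∀ n ≥ n₂, ∀ (c : ℕ) (A : Fin r → Fin n → ZMod p)
      (Y : (Fin r → ZMod p) → Fin (n + 1) → (Fin n → Bool) → Bool),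
      (∀ t : Fin r → ZMod p, t ≠ 0 → n ≤ 2 * (univ.filter fun i : Fin n => comb p t A i ≠ 0).card) →
        (∀ s g, ∃ J : Finset (Fin n), J.card ≤ Nat.log 2 n ∧ ∀ u v : Fin n → Bool, (∀ i ∈ J, u i = v i) →
          Y s g u = Y s g v) →
        (#{u : Fin n → Bool | ringWinU c (formStratR p A Y) u = true} : ℝ) ≤ (θ₀ + (1 - θ₀) / 2) * 2 ^ n :=
  form_reductionR p (fun {n} _ y => ∀ g, ∃ J : Finset (Fin n), J.card ≤ Nat.log 2 n ∧ ∀ u v : Fin n → Bool,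
      (∀ i ∈ J, u i = v i) → y g u = y g v) h1 (formJunta_small p hp) hθ₀ r

end SpreadForm

/-! ### §J′ the junta bias with an ARBITRARY junta bound `L` (`Q·L² ≤ n`), hence for polylog juntas `(log₂ n)^C`

The block-product estimate only needs `m ≥ q₀` non-interacting good blocks, i.e. `(4896 q₀ + 1)·L² ≤ n`; so `formJunta_small`
holds verbatim for `L`-juntas with any `L = o(√n)` — in particular for `(log₂ n)^C`-juntas, every `C` (`formJunta_small_pow`),
which is the junta budget the tree's rung `walkHardFJuntaCuts` tolerates and the robustness the slicing step of the rank ladder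
needs (a subcube of dimension `n/2` has budget `log₂ n − 1`). -/

section FormJuntaGen

variable (p : ℕ) [Fact p.Prime] {n : ℕ}

/-- CharDialSpreadRankA helper `formJunta_small_gen` (decomp-qadv land package; see the module docstring). -/
theorem formJunta_small_gen (hp : 5 ≤ p) : ∀ ε : ℝ, 0 < ε → ∃ Q : ℕ, ∀ (n L : ℕ), 1 ≤ L → Q * L ^ 2 ≤ n → 16 ≤ n →
    ∀ (c : ℕ) (a : Fin n → ZMod p) (y : Fin (n + 1) → (Fin n → Bool) → Bool),
      (∀ g, ∃ J : Finset (Fin n), J.card ≤ L ∧ ∀ u v : Fin n → Bool, (∀ i ∈ J, u i = v i) → y g u = y g v) →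
      n ≤ 2 * (univ.filter fun i : Fin n => a i ≠ 0).card →
        ∀ t : ZMod p, t ≠ 0 → ‖formSum p a c y t‖ ≤ ε * 2 ^ n := by
  classical
  intro ε hε
  have hκ0 := kappaF_nonneg p
  have hκ1 := kappaF_lt_one p hp
  obtain ⟨q₀, hq₀⟩ := exists_pow_lt_of_lt_one hε hκ1
  refine ⟨4896 * q₀ + 1, fun n L hℓ1 hlog hn16 c a y hy hdense t ht => ?_⟩
  choose J hJc hJ using hy
  -- candidate starts: good positions with room for a block
  set S₀ : Finset ℕ := (range n).filter fun k => k + 3 ≤ n ∧ aExt p a k ≠ 0 with hS₀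
  have hS₀card : (univ.filter fun i : Fin n => a i ≠ 0).card ≤ S₀.card + 2 := by
    have h1 : ((univ.filter fun i : Fin n => a i ≠ 0 ∧ i.val + 3 ≤ n).image fun i : Fin n => i.val) ⊆ S₀ := by
      intro k hk; rw [mem_image] at hk; obtain ⟨i, hi, rfl⟩ := hk; rw [mem_filter] at hi
      rw [hS₀, mem_filter, mem_range]; refine ⟨i.isLt, hi.2.2, ?_⟩
      unfold aExt; rw [dif_pos i.isLt]; exact hi.2.1
    have h2 : (univ.filter fun i : Fin n => ¬ (i.val + 3 ≤ n)).card ≤ 2 := by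
      calc _ ≤ (range 2).card := Finset.card_le_card_of_injOn (fun i : Fin n => n - 1 - i.val) (fun i hi => by
              have hi' : ¬ (i.val + 3 ≤ n) := by simpa using hi
              simp only [mem_coe, mem_range]; omega) (by
              intro i hi i' hi' hh
              have h3 : ¬ (i.val + 3 ≤ n) := by simpa using hi
              have h4 : ¬ (i'.val + 3 ≤ n) := by simpa using hi'
              ext; simp only at hh; omega)
        _ = 2 := card_range 2
    have h3 := card_le_card h1
    rw [card_image_of_injective _ Fin.val_injective] at h3
    calc (univ.filter fun i : Fin n => a i ≠ 0).card
        ≤ ((univ.filter fun i : Fin n => a i ≠ 0 ∧ i.val + 3 ≤ n) ∪ (univ.filter fun i : Fin n => ¬ (i.val + 3 ≤ n))).card :=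
          card_le_card (by
            intro i hi; rw [mem_filter] at hi; rw [mem_union, mem_filter, mem_filter]
            by_cases h : i.val + 3 ≤ n
            · exact Or.inl ⟨hi.1, hi.2, h⟩
            · exact Or.inr ⟨hi.1, h⟩)
      _ ≤ _ := card_union_le _ _
      _ ≤ S₀.card + 2 := add_le_add h3 h2
  -- one residue class mod 3: pairwise separated
  obtain ⟨r, -, hr⟩ := Finset.exists_le_card_fiber_of_mul_le_card_of_maps_to (s := S₀) (t := range 3) (f := fun k => k % 3)
    (fun k _ => mem_range.2 (Nat.mod_lt _ (by norm_num))) (by simp) (by rw [card_range]; exact Nat.mul_div_le _ 3)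
  set T := S₀.filter fun k => k % 3 = r with hTdef
  have hT3 : S₀.card ≤ 3 * T.card + 2 := by have := hr; omega
  have hTn : ∀ k ∈ T, k + 3 ≤ n := fun k hk => by
    have := (mem_filter.1 (mem_filter.1 hk).1).2; exact this.1
  have hTgd : ∀ k ∈ T, aExt p a k ≠ 0 := fun k hk => by
    have := (mem_filter.1 (mem_filter.1 hk).1).2; exact this.2
  have hTsep : ∀ k ∈ T, ∀ k' ∈ T, k ≠ k' → k + 3 ≤ k' ∨ k' + 3 ≤ k := fun k hk k' hk' hne => by
    have h1 := (mem_filter.1 hk).2; have h2 := (mem_filter.1 hk').2; omega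
  have hTle : T.card ≤ n :=
    (card_le_card (filter_subset _ _)).trans ((card_le_card (filter_subset _ _)).trans (card_range n).le)
  obtain ⟨m, k, hkT, hkinj, hni, hsize⟩ := exists_blocks J hJc T hTsep
  -- enough blocks
  have hm : q₀ ≤ m := by
    by_contra hlt; push Not at hlt
    have h12 : n ≤ 12 * T.card := by omega
    have hsz : T.card ^ 2 ≤ 2 * q₀ * (2 * ((n + 1) * (L + 1) ^ 2) + T.card) :=
      le_trans hsize (Nat.mul_le_mul_right _ (Nat.mul_le_mul_left _ hlt.le))
    have h1 : (L + 1) ^ 2 ≤ 4 * L ^ 2 := by nlinarith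
    have h2 : (n + 1) * (L + 1) ^ 2 ≤ (2 * n) * (4 * L ^ 2) := Nat.mul_le_mul (by omega) h1
    have h3 : T.card ≤ n * L ^ 2 := le_trans hTle (Nat.le_mul_of_pos_right _ (by positivity))
    have h4 : 2 * q₀ * (2 * ((n + 1) * (L + 1) ^ 2) + T.card) ≤ 34 * q₀ * (n * L ^ 2) := by
      nlinarith
    have h5 : n ^ 2 ≤ 144 * T.card ^ 2 := by nlinarith
    have h6 : n ^ 2 ≤ 4896 * q₀ * (n * L ^ 2) := by nlinarith
    have h7 : n ≤ 4896 * q₀ * L ^ 2 := by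
      have hn0 : 0 < n := by omega
      have : n * n ≤ (4896 * q₀ * L ^ 2) * n := by nlinarith
      exact Nat.le_of_mul_le_mul_right this hn0
    have h8 : 1 ≤ L ^ 2 := Nat.one_le_pow _ _ hℓ1
    nlinarith
  -- the two character sums
  have hkn : ∀ j, k j + 3 ≤ n := fun j => hTn _ (hkT j)
  have hksep : ∀ j j', j ≠ j' → k j + 3 ≤ k j' ∨ k j' + 3 ≤ k j := fun j j' h => hTsep _ (hkT j) _ (hkT j') (hkinj j j' h)
  have hkgd : ∀ j, aExt p a (k j) ≠ 0 := fun j => hTgd _ (hkT j)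
  have hQ := norm_sum_Qf_le p y c J hp hJ a ht m k hkn hksep hni hkgd
  have hQ0 := norm_sum_Qf_le p (fun _ _ => false) c J hp (fun _ _ _ _ => rfl) a ht m k hkn hksep hni hkgd
  have hplain : ∑ u, Qf p (fun _ _ => false) c a t u = ∑ u : Fin n → Bool, (ZMod.stdAddChar (t * linF p a u) : ℂ) :=
    sum_congr rfl fun u _ => by simp [Qf, fires]
  rw [hplain] at hQ0
  have e : ∀ u : Fin n → Bool, (if ringWinU c y u = true then (1 : ℂ) else 0) * (ZMod.stdAddChar (t * linF p a u) : ℂ) =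
      ((ZMod.stdAddChar (t * linF p a u) : ℂ) - Qf p y c a t u) / 2 := fun u => by
    rw [win_indicator]; unfold Qf; ring
  have hform : formSum p a c y t =
      ((∑ u : Fin n → Bool, (ZMod.stdAddChar (t * linF p a u) : ℂ)) - ∑ u, Qf p y c a t u) / 2 := by
    unfold formSum; rw [sum_congr rfl fun u _ => e u, ← sum_div, sum_sub_distrib]
  have hκm : kappaF p ^ m ≤ kappaF p ^ q₀ := pow_le_pow_of_le_one hκ0 hκ1.le hm
  have h2 : ‖(2 : ℂ)‖ = 2 := by simp
  have h2n : (0 : ℝ) ≤ 2 ^ n := by positivity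
  rw [hform, norm_div, h2]
  calc _ ≤ (‖∑ u : Fin n → Bool, (ZMod.stdAddChar (t * linF p a u) : ℂ)‖ + ‖∑ u, Qf p y c a t u‖) / 2 := by
        gcongr; exact norm_sub_le _ _
    _ ≤ (2 ^ n * kappaF p ^ m + 2 ^ n * kappaF p ^ m) / 2 := by gcongr
    _ = 2 ^ n * kappaF p ^ m := by ring
    _ ≤ 2 ^ n * kappaF p ^ q₀ := mul_le_mul_of_nonneg_left hκm h2n
    _ ≤ ε * 2 ^ n := by rw [mul_comm]; exact mul_le_mul_of_nonneg_right hq₀.le h2n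



end FormJuntaGen
end Summit.QuantumAdvantage.AdviceFreeQNC0.WindowCounter
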